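import Literature.AnabelianGeometry.EtaleTheta.Discharge.Sec5Thm57FinalKnitV2
import Literature.AnabelianGeometry.SemiGraphs.TemperoidsGaloisHomTorsor
import Literature.AlgebraicGeometry.Frobenioids.BaseSectionImage

/-!
# [EtTh] §5, Thm. 5.7 at the genuine connected tower: the §4 binders `hebs` (DISCHARGED modulo «`A_N^bs` characteristic»)
# and `hArises` (KERNEL OBSTRUCTION: unmeetable unless `Ψ` fixes `A_1` on the nose) of the closer `…_final_v2`

Mochizuki, *The étale theta function and its Frobenioid-theoretic manifestations*, Publ. RIMS **45** (2009)
[MochizukiEtTh2009]: Def. 4.1 (iv)(e) p.313 (PDF p.87) «`G, α′, α″` arise from a base-Frobenius pair of `C`»; Prop. 4.2 (iv)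
p.315 (PDF p.89) «`Ā′ : A_N^bs ⥲ Ā_N^bs` an isomorphism of `D` such that …» (the base isomorphism is a HYPOTHESIS of (iv));
Rmk. 4.3.2 p.318–319 (PDF pp.92–93); Thm. 5.7 p.329–330 (PDF pp.103–104), proof «by considering compatible systems as in
Remark 4.3.2»; proof of Thm. 5.6 p.329 (PDF p.103) «such that `S₂^bs` is "characteristic" [i.e., its isomorphism class is
preserved by arbitrary self-equivalences of `D`]».  Mochizuki, *The geometry of Frobenioids I*, Kyushu J. Math. **62** (2008)
[MochizukiFrdI2008], Def. 2.7 (i)(a) p.51 «`P` is a skeleton».  Mochizuki, *Semi-graphs of anabelioids*, Publ. RIMS **42**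
(2006) [MochizukiSemiAnbd2006], Rmk. 3.1.3 p.34, Prop. 3.2 p.35.

abc-iut cell, layer L2, abc-iut-L2-lead (gen 4) ROW **R415 «§4-FACT BINDERS `hivP′` · `hArises` · `hebs` OF THE THM 5.7 CLOSER AT THE
GENUINE CONNECTED TOWER»** (seat abc-iut-w6-d077 gen 6).  PROOF-ONLY (0 definitions, 0 instances, no new named fact; nothing
landed is edited or restated).  The binders are those of abc-iut-L2-d4's `thetaRootPreservedAll_ofConnectedTemperoidYddFamily_final_v2`
(`Discharge/Sec5Thm57FinalKnitV2.lean`, verbatim shapes), at `S := BiKummerSetting.mkOfConnectedTemperoidYddTower X tf hZ hP NH 𝒯 ιX`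
(= abc-iut-L2-t9's `mkOfModelCanonical` over the connected temperoid `B^temp(Π^tp_X)⁰`, so that Def. 4.1 (iv)(e) IS
`TemperedFrobenioid.ArisesFromBaseFrobeniusPair` and `S.base.map = ModelFrobenioid.baseMap`, definitionally).

WHAT IS PROVED.
* `hebs` — **DISCHARGED modulo the level-`N` twin of the closer's own `hcharN`** (`hebs_of_isTopCharacteristic`): for every anchor
  `α₁ : Ψ(A_1) ≅ A_1` and every `N`, a base isomorphism `ebs : A_N^bs ≅ Ψ(A_N)^bs` with `α_{1,N}^bs = ebs ≫ (Ψ(α_{1,N}) ≫ α₁)^bs` EXISTS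
  as soon as `N_{A_N} = Ker(Π^tp_X ↠ Gal(A_N^bs))` is characteristic in the topological group `Π^tp_X` (print's «`S^bs` is
  "characteristic"», the [EtTh] Prop. 2.4-class clause, in abc-iut-w4-d008's currency `IsTopCharacteristic`).  Proof: abc-iut-w5-d245's
  `BiKummerSetting.nonempty_baseIso_map_of_isTopCharacteristic` ([FrdI] Thm. 3.4 (v) `Ψ^bs` + [SemiAnbd] Prop. 3.2: `Ψ(A_N)^bs ≅ A_N^bs`)
  and abc-iut's `GaloisObjects.exists_aut_comp_eq_of_isGaloisObj_connectedPart` ([SemiAnbd] Rmk. 3.1.3: a Galois object is an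
  `Aut`-torsor over every connected target, so the two arrows `A_N^bs ⇉ A_1^bs` differ by an automorphism of `A_N^bs`).  Inputs beyond
  the closer's binders `h`, `hnd`: NONE but `hcharAN`.
* `hArises` — **KERNEL OBSTRUCTION** (`TemperedFrobenioid.ArisesFromBaseFrobeniusPair.eq_of_iso`, `obj_eq_of_hArises`,
  `not_hArises_of_obj_ne`): in the tree's reading of Def. 4.1 (iv)(e) over abc-iut-L1's [FrdI] Def. 2.7 (`IsBaseFrobeniusPair`: the
  base-section `P` is a SKELETON equivalent to `D`, whence abc-iut-L1's `IsBaseSection.eq_of_iso`: two objects of `P` isomorphic in `C`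
  are EQUAL), data `G, α″, α′ : A → B` can arise from a base-Frobenius pair with `A ≅ B` only if `A = B` ON THE NOSE.  The closer's
  binder asks this, at `N = 1`, of the re-anchored arrow `Ψ((D 1).α′) ≫ α₁ : Ψ(A_1) → A_1` whose source and target ARE isomorphic (by the
  anchor `α₁` itself); hence `hArises` (all anchors, all levels) forces `h44.Ψ.functor.obj (R 1).AN = (R 1).AN`, and is UNSATISFIABLE for
  every self-equivalence `Ψ` that moves the object `A_1` inside its isomorphism class — for such `Ψ` the closer is vacuous.  (abc-iut-L1
  records the same restriction in `ModelFrobenioidBaseSectionThrough.lean`: «bases not isomorphic (or `φ = id`)».)  This is a statement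
  about OUR typed text: print asks (e) of the ORIGINAL Def. 4.1 (iv) datum only, and re-anchors along isomorphisms freely (Rmk. 4.3.2);
  abc-iut-f-121's `BiKummerRootTransport` already flagged the re-anchoring law `hArises` as «not derivable from a law-free field» — at the
  genuine data it is not a missing law but is REFUTED by the skeleton axiom whenever it is not trivial.  REPAIR (for the closer's lineage,
  not done here): re-type clause (e) of the re-anchored datum invariantly, e.g. (e″) «`α′ ≫ c` is `P`-distinguished for some isomorphism
  `c` onto an object of `P`» (what the consumers use: `ArisesFromBaseFrobeniusPair.exists_natural` and [FrdI] Prop. 5.6 conjugacy at the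
  codomain, both insensitive to re-anchoring), or quantify the anchor only over the identity when `Ψ(A_1) = A_1`.
* `hivP′` — not treated in this file: it is abc-iut-f-121's clause `hivP` (Prop. 4.2 (iv) AT the `u₁`-twisted level-1 pair, whose domain
  `A_1` is not `A_⊙`); every landed producer of Prop. 4.2 (iv) (`Prop42Sub.prop42_iv_of_subnodes`, `zetaA_of_unitRootsUpstairs`, …) is typed
  at domain `A_⊙`, so the discharge is a port of L06–L08 to an arbitrary domain modulo the L05 clause at that pair (sequel).
HONEST FRAMING: kernel-checked statements about data so typed; `hcharAN` is a hypothesis ON THE CHOSEN ROOTS, asserted nowhere; nothing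
asserts that such data exist for an actual curve; typed ≠ discharged; no side is taken on [IUTchIII] Cor. 3.12 or on any author.
-/

noncomputable section

open CategoryTheory Opposite

namespace Literature.AnabelianGeometry.EtaleTheta

open Literature.AlgebraicGeometry.Frobenioids Literature.AnabelianGeometry.SemiGraphs
  Literature.AnabelianGeometry.SemiGraphs.GaloisObjects

/-! ## §1. Def. 4.1 (iv)(e) in the canonical reading joins EQUAL objects only, among isomorphic ones -/

namespace TemperedFrobenioid

universe u₀ v₀ u v w

variable {D₀ : Type u₀} [Category.{v₀} D₀] {V : FrdIMonoidStub.{w}}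
  {T : RealifiedDivisorMonoids (D₀ := D₀) V} {D : Type u} [Category.{v} D]
  {VD : FrdICatStub.{u, v, w} D} (C : TemperedFrobenioid T D VD)

/-- **If `G, α″, α′ : A → B` arise from a base-Frobenius pair `(P, F)` of `C` and `A ≅ B` in `C`, then `A = B`.**  `α′` is
`P`-distinguished, so `A, B ∈ Ob(P)`; a base-section is a skeleton equivalent to the base ([FrdI] Def. 2.7 (i)(a),(c)), and two of its
objects that are isomorphic in `C` are equal (abc-iut-L1's `IsBaseSection.eq_of_iso`).
[cite: MochizukiFrdI2008, Def. 2.7(i) p.51] [cite: MochizukiEtTh2009, Def 4.1 p.313 (PDF p.87)] -/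
theorem ArisesFromBaseFrobeniusPair.eq_of_iso {A B : C.category} {G : Subgroup (Aut A)} {α₂ : A ⟶ A} {α₁ : A ⟶ B}
    (h : C.ArisesFromBaseFrobeniusPair G α₂ α₁) (e : A ≅ B) : A = B := by
  obtain ⟨P, Fr, hPF, -, h₁, -⟩ := h
  exact hPF.isBaseSection.eq_of_iso C.toElem (P.obj_of_hom α₁ h₁).1 (P.obj_of_hom α₁ h₁).2 e

/-- Contrapositive: between DISTINCT isomorphic objects no arrow `α′` can be part of data arising from a base-Frobenius pair.
[cite: MochizukiFrdI2008, Def. 2.7(i) p.51] [cite: MochizukiEtTh2009, Def 4.1 p.313 (PDF p.87)] -/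
theorem ArisesFromBaseFrobeniusPair.not_of_ne {A B : C.category} {G : Subgroup (Aut A)} {α₂ : A ⟶ A} {α₁ : A ⟶ B}
    (e : A ≅ B) (hne : A ≠ B) : ¬ C.ArisesFromBaseFrobeniusPair G α₂ α₁ :=
  fun h => hne (h.eq_of_iso C e)

end TemperedFrobenioid

/-! ## §2. The binders `hArises` and `hebs` of `…_final_v2` at the genuine connected tower -/

namespace ThetaFrobenioidTower

universe v₀

variable {K : Type} [Field K] {X : SemiGraphs.TemperedArithmeticGroup.{0} K} {D₀ : Type} [Category.{v₀} D₀]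
  {V : FrdIMonoidStub.{0}} {T₀ : RealifiedDivisorMonoids (D₀ := D₀) V}
  {VD : FrdICatStub.{1, 0, 0} (ConnectedPart (BTemp X.Pi))}
  {tf : TemperedFrobenioid T₀ (ConnectedPart (BTemp X.Pi)) VD} {hZ : tf.monoidType = MonoidType.Z}
  {hP : ∀ A : (ConnectedPart (BTemp X.Pi))ᵒᵖ, IsPerfect (tf.Φ.carrier A)}
  {NH : Subgroup (Field.absoluteGaloisGroup K) → tf.category → ℕ+ → Prop}
  {E : Set ℕ+} (𝒯 : ThetaEnvTower.{0} E) (ιX : 𝒯.PiX ≃ₜ* X.Pi)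
  {pullFrac : ∀ {A A' : (BiKummerSetting.mkOfConnectedTemperoidYddTower X tf hZ hP NH 𝒯 ιX).C} (_ : A' ⟶ A),
    (BiKummerSetting.mkOfConnectedTemperoidYddTower X tf hZ hP NH 𝒯 ιX).biratUnits A →
      (BiKummerSetting.mkOfConnectedTemperoidYddTower X tf hZ hP NH 𝒯 ιX).biratUnits A'}
  {lv : ℕ+}
  {θ : (BiKummerSetting.mkOfConnectedTemperoidYddTower X tf hZ hP NH 𝒯 ιX).biratUnits
    (BiKummerSetting.mkOfConnectedTemperoidYddTower X tf hZ hP NH 𝒯 ιX).Aodot}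
  {Bl : (BiKummerSetting.mkOfConnectedTemperoidYddTower X tf hZ hP NH 𝒯 ιX).C}
  {Pl : (BiKummerSetting.mkOfConnectedTemperoidYddTower X tf hZ hP NH 𝒯 ιX).FractionPair θ Bl}
  {Rl : (BiKummerSetting.mkOfConnectedTemperoidYddTower X tf hZ hP NH 𝒯 ιX).NthRoot θ Pl lv pullFrac}
  (h : ModelFrobenioid.Hypotheses tf.divisorMonoid tf.ratFnFunctor)
  (R : ∀ N : ℕ+, (BiKummerSetting.mkOfConnectedTemperoidYddTower X tf hZ hP NH 𝒯 ιX).NthRoot Rl.root Rl.pair N pullFrac)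
  (α : ∀ {N N' : ℕ+}, (N : ℕ) ∣ N' → ((R N').AN ⟶ (R N).AN))
  (h44 : BiKummerSetting.Thm44Hyp (BiKummerSetting.mkOfConnectedTemperoidYddTower X tf hZ hP NH 𝒯 ιX)
    (BiKummerSetting.mkOfConnectedTemperoidYddTower X tf hZ hP NH 𝒯 ιX))
  (D : ∀ N : ℕ+, (BiKummerSetting.mkOfConnectedTemperoidYddTower X tf hZ hP NH 𝒯 ιX).BaseFrobeniusTypeData (α (one_dvd_level N)))

/-! ### `hArises`: the obstruction -/

/-- **The closer's binder `hArises`, read at level `N = 1`, forces `Ψ` to FIX the object `A_1` on the nose.**  At `N = 1` the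
re-anchored arrow `Ψ((D 1).α′) ≫ α₁` goes from `Ψ(A_1)` to `A_1`, which are isomorphic by the anchor `α₁` itself; §1 applies.
[cite: MochizukiEtTh2009, Def 4.1 p.313 (PDF p.87); Rmk 4.3.2 p.318–319 (PDF pp.92–93)] [cite: MochizukiFrdI2008, Def. 2.7(i) p.51] -/
theorem obj_eq_of_hArises_one (α₁ : h44.Ψ.functor.obj (R 1).AN ≅ (R 1).AN)
    (hA : (BiKummerSetting.mkOfConnectedTemperoidYddTower X tf hZ hP NH 𝒯 ιX).ArisesFromBaseFrobeniusPair
        ((D 1).G.map (h44.Ψ.functor.mapAut (R 1).AN)) (h44.Ψ.functor.map (D 1).α₂) (h44.Ψ.functor.map (D 1).α₁ ≫ α₁.hom)) :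
    h44.Ψ.functor.obj (R 1).AN = (R 1).AN :=
  TemperedFrobenioid.ArisesFromBaseFrobeniusPair.eq_of_iso tf hA α₁

/-- **`hArises` (all anchors, all levels — the binder of `…_final_v2` verbatim) implies `Ψ(A_1) = A_1` for every anchor `α₁`.**
[cite: MochizukiEtTh2009, Def 4.1 p.313 (PDF p.87); Thm 5.7 p.329–330 (PDF pp.103–104)] [cite: MochizukiFrdI2008, Def. 2.7(i) p.51] -/
theorem obj_eq_of_hArises
    (hArises : ∀ (α₁ : h44.Ψ.functor.obj (R 1).AN ≅ (R 1).AN) (N : ℕ+),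
      (BiKummerSetting.mkOfConnectedTemperoidYddTower X tf hZ hP NH 𝒯 ιX).ArisesFromBaseFrobeniusPair
        ((D N).G.map (h44.Ψ.functor.mapAut (R N).AN)) (h44.Ψ.functor.map (D N).α₂) (h44.Ψ.functor.map (D N).α₁ ≫ α₁.hom))
    (α₁ : h44.Ψ.functor.obj (R 1).AN ≅ (R 1).AN) :
    h44.Ψ.functor.obj (R 1).AN = (R 1).AN :=
  obj_eq_of_hArises_one 𝒯 ιX R α h44 D α₁ (hArises α₁ 1)

/-- **The binder `hArises` is UNSATISFIABLE whenever `Ψ` moves `A_1` inside its isomorphism class** (an anchor `α₁ : Ψ(A_1) ≅ A_1`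
exists but `Ψ(A_1) ≠ A_1`): for such `Ψ` the closer `…_final_v2` is vacuous.
[cite: MochizukiEtTh2009, Thm 5.7 p.329–330 (PDF pp.103–104); Def 4.1 p.313 (PDF p.87)] [cite: MochizukiFrdI2008, Def. 2.7(i) p.51] -/
theorem not_hArises_of_obj_ne (α₁ : h44.Ψ.functor.obj (R 1).AN ≅ (R 1).AN)
    (hne : h44.Ψ.functor.obj (R 1).AN ≠ (R 1).AN) :
    ¬ ∀ (α₁ : h44.Ψ.functor.obj (R 1).AN ≅ (R 1).AN) (N : ℕ+),
      (BiKummerSetting.mkOfConnectedTemperoidYddTower X tf hZ hP NH 𝒯 ιX).ArisesFromBaseFrobeniusPair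
        ((D N).G.map (h44.Ψ.functor.mapAut (R N).AN)) (h44.Ψ.functor.map (D N).α₂) (h44.Ψ.functor.map (D N).α₁ ≫ α₁.hom) :=
  fun hArises => hne (obj_eq_of_hArises 𝒯 ιX R α h44 D hArises α₁)

/-! ### `hebs`: discharged modulo «`A_N^bs` characteristic» -/

include h in
/-- **The binder `hebs` of `…_final_v2` DISCHARGED modulo the level-`N` Prop. 2.4-class clause** «`N_{A_N} = Ker(Π^tp_X ↠ Gal(A_N^bs))`
is characteristic in `Π^tp_X`» (`hcharAN`; the closer already carries its `N = 1` instance `hcharN`), together with the closer's own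
binders `h` ([FrdI] Thm. 5.2 hypotheses) and `hnd` (`Φ` non-dilating): for every anchor `α₁ : Ψ(A_1) ≅ A_1` and every `N` there is
`ebs : A_N^bs ≅ Ψ(A_N)^bs` with `α_{1,N}^bs = ebs ≫ (Ψ(α_{1,N}) ≫ α₁)^bs`.  Proof: `Ψ(A_N)^bs ≅ A_N^bs` by abc-iut-w5-d245's
`nonempty_baseIso_map_of_isTopCharacteristic` ([FrdI] Thm. 3.4 (v), [SemiAnbd] Prop. 3.2), then the two arrows `A_N^bs ⇉ A_1^bs` of the
connected temperoid differ by an automorphism of the Galois object `A_N^bs` ([SemiAnbd] Rmk. 3.1.3, `exists_aut_comp_eq_of_isGaloisObj_connectedPart`).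
[cite: MochizukiEtTh2009, Prop 4.2 (iv) p.315 (PDF p.89); Thm 5.6 proof p.329 (PDF p.103); Rmk 4.3.2 p.318–319 (PDF pp.92–93)]
[cite: MochizukiSemiAnbd2006, Rmk 3.1.3 p.34; Prop 3.2 p.35] -/
theorem hebs_of_isTopCharacteristic (hnd : IsNonDilatingOn tf.divisorMonoid)
    (hcharAN : ∀ N : ℕ+, IsTopCharacteristic X.Pi (galoisSurjOf X.isTempered (R N).AN.base.obj (R N).αData.isGalois).ker)
    (α₁ : h44.Ψ.functor.obj (R 1).AN ≅ (R 1).AN) (N : ℕ+) :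
    ∃ ebs : (BiKummerSetting.mkOfConnectedTemperoidYddTower X tf hZ hP NH 𝒯 ιX).base.obj (R N).AN ≅
        (BiKummerSetting.mkOfConnectedTemperoidYddTower X tf hZ hP NH 𝒯 ιX).base.obj (h44.Ψ.functor.obj (R N).AN),
      (BiKummerSetting.mkOfConnectedTemperoidYddTower X tf hZ hP NH 𝒯 ιX).base.map (α (one_dvd_level N)) =
        ebs.hom ≫ (BiKummerSetting.mkOfConnectedTemperoidYddTower X tf hZ hP NH 𝒯 ιX).base.map
          (h44.Ψ.functor.map (α (one_dvd_level N)) ≫ α₁.hom) := by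
  -- `Ψ(A_N)^bs ≅ A_N^bs` from «`N_{A_N}` characteristic»
  obtain ⟨e₀⟩ := BiKummerSetting.nonempty_baseIso_map_of_isTopCharacteristic (X := X) (tf := tf) (hZ := hZ) (hP := hP)
    (NH := NH) h hnd h44.Ψ (R N).AN (R N).αData.isGalois (hcharAN N)
  -- the two arrows `A_N^bs ⇉ A_1^bs` differ by an automorphism of the Galois object `A_N^bs`
  obtain ⟨σ, hσ⟩ := exists_aut_comp_eq_of_isGaloisObj_connectedPart (R N).AN.base (R 1).AN.base (R N).αData.isGalois
    (e₀.inv ≫ (BiKummerSetting.mkOfConnectedTemperoidYddTower X tf hZ hP NH 𝒯 ιX).base.map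
      (h44.Ψ.functor.map (α (one_dvd_level N)) ≫ α₁.hom))
    ((BiKummerSetting.mkOfConnectedTemperoidYddTower X tf hZ hP NH 𝒯 ιX).base.map (α (one_dvd_level N)))
  refine ⟨σ ≪≫ e₀.symm, ?_⟩
  rw [Iso.trans_hom, Iso.symm_hom, Category.assoc]
  exact hσ

end ThetaFrobenioidTower

end Literature.AnabelianGeometry.EtaleTheta

end
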